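import Summits.BirchSwinnertonDyer.BirchSwinnertonDyer.Theorems.ClassRecordThreeExceptionalZeroRoadTriangle
import Literature.NumberTheory.EllipticCurves.Rank1Residual.MultiplicativeThreeTowerProofs
import Literature.NumberTheory.EllipticCurves.Rank1Residual.X9NoEntry
import HarnessLib

/-!
# Route `ClassRecordThree` ∕ class X11b at `3`: gen 1's «Mazur's main conjecture at `(E,3)` ⟺
# `BSD(E,3)`» readings on B10 pairs WITHOUT the mod-`9` image certificate (cell `bsd-stepL`, seat
# `bsd-stepL-mult-p4` g2; `--supports stmt-BirchSwinnertonDyer-19106 --as helper`)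

Cell `bsd-stepL` (D-0131 (3) middle tier, seat `bsd-stepL-mult-p4`). THEOREMS ONLY, CONDITIONAL on
the PUBLISHED named facts in the binders, on ONE REGMULT row per pair (Schneider for THE §4.2 datum;
rung I1 — the predicate of crux 19106 `SchneiderAtThree` on the non-split (ram) locus) and, on split
pairs, on the exceptional display (beyond print at `3`); no definition, no new fact, no `sorry`;
nothing about any curve is asserted (TARGET T7).

Gen 1 (`…ExceptionalZeroRoadTriangle.lean` §4) read the exz road backwards at `p = 3` in certificate
currency with a hypothesis `h9 : ρ̄_{E,9}` onto (to get every `ρ̄_{E,3^n}` onto for Kato). That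
hypothesis is DISCHARGEABLE: on X11b@3 the `3`-adic tower follows from `ρ̄_{E,3}` onto by the tree
theorem `Rank1Residual.surjective_pow_of_mult_of_surj` (Tate line; Wuthrich's Lemma 20 binder-free on
the multiplicative locus), and `ρ̄_{E,3}` onto is automatic on the (ram) locus (`surj_of_irr_of_ram`).
So on a B10 pair — `E[3]` irreducible and a (ram) prime, NOTHING more about the image —:
* NON-SPLIT (722 TRUE-OPEN classes): ONE REGMULT row ⟹ [Mazur's IMC at `(E,3)` ⟺ `BSD(E,3)`], every
  class-level input PUBLISHED (`Three.mazurMainConjectureAt_iff_bsdp_of_ram_nonsplit_of_cert`) — road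
  (a)'s flagged input (Skinner 2016 Thm. A's conclusion, T13) is pair-by-pair EXACTLY the target;
* SPLIT (961): ONE split row + the display ⟹ the same iff (`…_of_ram_split_of_cert_of_conjecture`);
* any X11b@3 ∩ `Surj` pair with the bundled regulator predicate (`…_of_surj_of_regulatorNonvanishing`).
Route-independent module (no `Theses` import). CONDITIONAL; closes nothing. References: [Wuthrich2014] Thm. 3, Cor. 19, Lemma 20;
[SteinWuthrich2013] Thm. 6.1, §4.2; [Disegni2020] Thm. 1 (§1.2); [Skinner2016PacificMC] Thm. A (shape
only); [Miller2011LMS] Def. 1.1. Cell files: HOME/mult-p4/EXZ-ROAD-MEMO-g1.md §1, -g2.md §2 (F3).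
-/

set_option autoImplicit false

-- Theorems files of this problem live in `Summit.BirchSwinnertonDyer.BirchSwinnertonDyer.Theorems.*`.
set_option linter.dupNamespace false

noncomputable section

open scoped Classical MatrixGroups ModularForm

open CongruenceSubgroup WeierstrassCurve Literature.NumberTheory.EllipticCurves
  Literature.NumberTheory.EllipticCurves.ModularForms
  Literature.NumberTheory.EllipticCurves.Rank1Residual
  Literature.NumberTheory.EllipticCurves.Rank1Residual.Typed
  Literature.NumberTheory.EllipticCurves.SteinWuthrich2013
  Literature.NumberTheory.EllipticCurves.Wuthrich2014

namespace Summit.BirchSwinnertonDyer.BirchSwinnertonDyer.Theorems.ExceptionalZeroRoad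

open Summit.BirchSwinnertonDyer.Rank1Residual Summit.BirchSwinnertonDyer.Rank1Residual.X11b
  Summit.BirchSwinnertonDyer.Rank1Residual.X11b.Three

/-! ### Gen 1's «Mazur's main conjecture at the pair ⟺ BSD(E,3)» readings WITHOUT the mod-`9` image certificate -/

section ImageFree

variable (W : WeierstrassCurve ℚ) [W.IsElliptic] [W.IsGloballyMinimal]

/-- **B10 NON-SPLIT (ram) pair (the 722 TRUE-OPEN non-split classes): granted ONE REGMULT row
`RegMult.CertNonsplit W 3 P m` — and NOTHING about the image beyond `E[3]` irreducible — Mazur's main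
conjecture at `(E,3)` (road (a)'s flagged input, Skinner 2016 Thm. A's conclusion) ⟺ `BSD(E,3)`.**
Gen 1's `Three.mazurMainConjectureAt_iff_bsdp_of_nonsplit_of_cert_of_nine` with its hypothesis
`ρ̄_{E,9}` onto DISCHARGED: `Ram ⟹ Surj` (`surj_of_irr_of_ram`) and `Mult ∧ Surj ⟹` tower
(`surjective_pow_of_mult_of_surj`). Every class-level input PUBLISHED (Kato, SW 6.1 + §4.2, Disegni
Thm. 1 non-split clause, Gross–Zagier I (7.3), GZK, parametrisation). CONDITIONAL on the row;
nothing booked. [cite: Disegni2020, Thm. 1 (§1.2) = Thm. 4 first bullet (§3.2)]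
[cite: Wuthrich2014, Thm. 3, Cor. 19, Lemma 20] [cite: SteinWuthrich2013, Thm. 6.1, §4.2 (p. 15)]
[cite: Skinner2016PacificMC, Thm. A (shape only)] [cite: Miller2011LMS, Def. 1.1] -/
theorem Three.mazurMainConjectureAt_iff_bsdp_of_ram_nonsplit_of_cert
    (hKato : kato_charIdeal_dvd_multiplicative_of_surjective) (hJn : thm61_nonsplitMultiplicative)
    (hHn : exists_isMultCanonical) (hDf : Disegni2020.thm1_padicBSD_rankOne_multiplicative)
    (hGZ : GrossZagier1986_thm_I_7_3) (hGZK : rank_eq_analyticRank_of_analyticRank_le_one)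
    (hpar : nonempty_modularParametrizationData)
    (hX : ClassX11b W 3) (hram : Ram W 3) (hns : ¬ W.HasSplitMultiplicativeReductionAtPrime 3)
    {P : W.toAffine.Point} {m : ℕ} (hc : RegMult.CertNonsplit W 3 P m) :
    X2.MazurMainConjectureAt W 3 ↔ BSDp W 3 :=
  mazurMainConjectureAt_iff_bsdp_of_nonsplit_of_schneider W 3 hKato hJn hHn hGZ hGZK hpar
    (fun hf ϖ hϖ0 hϖ _ hq0 hq1 hqj L hL Dh hDh =>
      Disegni2020.thm1_padicBSD_rankOne_multiplicative.nonsplit hDf W 3 hX.2.1 hX.2.2.1 hX.1 hf ϖ hϖ0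
        hϖ hns hq0 hq1 hqj L hL Dh hDh)
    hX hns (surjective_pow_of_mult_of_surj W (by decide) hX.2.2.1 (surj_of_irr_of_ram W 3 hX.2.2.2 hram))
    (RegMult.schneiderHalf_nonsplit_of_cert (mordellWeilRank_eq_one_of_analyticRank hGZK hX.1) hc)

/-- **B10 SPLIT (ram) pair (the 961 TRUE-OPEN split classes): granted ONE split row
`RegMult.CertSplit W 3 P m` and the exceptional display at `3` — and nothing about the image beyond
irreducibility — Mazur's main conjecture at `(E,3)` ⟺ `BSD(E,3)`.** Gen 1's
`Three.mazurMainConjectureAt_iff_bsdp_of_split_of_cert_of_nine_of_conjecture` with `ρ̄_{E,9}` onto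
DISCHARGED. CONDITIONAL on the row and the UNPROVED display; nothing booked.
[cite: Wuthrich2014, Thm. 3, Cor. 19, Lemma 20] [cite: SteinWuthrich2013, Thm. 6.1, §4.2 (p. 16)]
[cite: MazurTateTeitelbaum1986Invent, §II.10] [cite: Miller2011LMS, Def. 1.1] -/
theorem Three.mazurMainConjectureAt_iff_bsdp_of_ram_split_of_cert_of_conjecture
    (hKato : kato_charIdeal_dvd_multiplicative_of_surjective) (hJs : thm61_splitMultiplicative)
    (hHs : exists_isSplitMultCanonical) (hGZ : GrossZagier1986_thm_I_7_3)
    (hGZK : rank_eq_analyticRank_of_analyticRank_le_one) (hpar : nonempty_modularParametrizationData)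
    (hX : ClassX11b W 3) (hram : Ram W 3) (hsplit : W.HasSplitMultiplicativeReductionAtPrime 3)
    {P : W.toAffine.Point} {m : ℕ} (hc : RegMult.CertSplit W 3 P m)
    (hC : ClassClosure.RelativeExceptionalLeadingTermAt W 3) :
    X2.MazurMainConjectureAt W 3 ↔ BSDp W 3 :=
  mazurMainConjectureAt_iff_bsdp_of_split_of_conjecture_of_schneider W 3 hKato hJs hHs hGZ hGZK hpar
    hX hsplit (surjective_pow_of_mult_of_surj W (by decide) hX.2.2.1 (surj_of_irr_of_ram W 3 hX.2.2.2 hram)) hC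
    (RegMult.schneiderHalf_split_of_cert (mordellWeilRank_eq_one_of_analyticRank hGZK hX.1) hc)

/-- **Any X11b@3 pair with `ρ̄_{E,3}` onto (no mod-`9` certificate) and the bundled regulator
predicate, the display demanded only if split: Mazur's main conjecture at `(E,3)` ⟺ `BSD(E,3)`.**
CONDITIONAL; nothing booked. [cite: Wuthrich2014, Thm. 3, Cor. 19, Lemma 20]
[cite: SteinWuthrich2013, Thm. 6.1, §4.2] [cite: Disegni2020, Thm. 1 (§1.2)] [cite: Miller2011LMS, Def. 1.1] -/
theorem Three.mazurMainConjectureAt_iff_bsdp_of_surj_of_regulatorNonvanishing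
    (hKato : kato_charIdeal_dvd_multiplicative_of_surjective) (hJs : thm61_splitMultiplicative)
    (hJn : thm61_nonsplitMultiplicative) (hHs : exists_isSplitMultCanonical)
    (hHn : exists_isMultCanonical) (hDf : Disegni2020.thm1_padicBSD_rankOne_multiplicative)
    (hGZ : GrossZagier1986_thm_I_7_3) (hGZK : rank_eq_analyticRank_of_analyticRank_le_one)
    (hpar : nonempty_modularParametrizationData)
    (hX : ClassX11b W 3) (hsurj : Surj W 3) (hReg : ClassClosure.RegulatorNonvanishingAt W 3)
    (hC : W.HasSplitMultiplicativeReductionAtPrime 3 → ClassClosure.RelativeExceptionalLeadingTermAt W 3) :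
    X2.MazurMainConjectureAt W 3 ↔ BSDp W 3 := by
  by_cases hsplit : W.HasSplitMultiplicativeReductionAtPrime 3
  · exact mazurMainConjectureAt_iff_bsdp_of_split_of_conjecture_of_schneider W 3 hKato hJs hHs hGZ hGZK
      hpar hX hsplit (surjective_pow_of_mult_of_surj W (by decide) hX.2.2.1 hsurj) (hC hsplit) hReg.2
  · exact mazurMainConjectureAt_iff_bsdp_of_nonsplit_of_schneider W 3 hKato hJn hHn hGZ hGZK hpar
      (fun hf ϖ hϖ0 hϖ _ hq0 hq1 hqj L hL Dh hDh =>
        Disegni2020.thm1_padicBSD_rankOne_multiplicative.nonsplit hDf W 3 hX.2.1 hX.2.2.1 hX.1 hf ϖ hϖ0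
          hϖ hsplit hq0 hq1 hqj L hL Dh hDh)
      hX hsplit (surjective_pow_of_mult_of_surj W (by decide) hX.2.2.1 hsurj) hReg.1

end ImageFree

end Summit.BirchSwinnertonDyer.BirchSwinnertonDyer.Theorems.ExceptionalZeroRoad

end
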